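import Literature.MathematicalPhysics.QuantumFieldTheory.Balaban1983to89.B12B0LoopGeometry267

/-!
# [Balaban1987RG1] p. 267: HOW THE (0.4) AVERAGE AT `c` SEES THE VARIABLE AT `b₀(c)` — replacing `V(b₀(c))` by `u` multiplies the
# coarse bond variable `V(c)` by `T` on the left, right-multiplies every OFF-AXIS loop variable by `T⁻¹`, and CONJUGATES every ON-AXIS loop
# variable by `T`, where `T = g·V(b₀(c))⁻¹u·g⁻¹` is the fluctuation at `b₀(c)` transported to the block centre (`g` = the transport
# `emb c₋ → b₀(c)₊` along the axis); and the loops at `c` are blind to every foreign `b₀(c′)`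

Cell `pub-ymgap` (YM-PLAN Track A), seat `pub-ymgap-dag-n09-w4` g3 — STRUCTURE half of the nonlinear p. 266–267 rider («restrictions on
B′(b₀(c)), with the constant ε₁ replaced by O(ε₁), because these variables can be expressed in terms of the remaining ones»); consumer
`B12B0RestrictionNonlinear267`.  Helper toward K1⁷ (stmt-QuantumFields-20542), count-neutral.  Built on `B12B0LoopGeometry267` (on∕off-axis loops,
line splitting, the on-axis path identity) and `BlockAveragingEMLProp2.loopHol_eq` (the four-segment factorisation of a (0.4) loop).

WHAT IS HERE (group algebra over the tree's `loopHol` ∕ `axialAvg`; any gauge group; 0 `def`, 0 `sorry`):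
* `axialAvg_update_b0` — `V′(c) = T·V(c)` for `V′ = V` with `u` at `b₀(c)`;
* `loopHol_update_b0_of_offAxis` — `W_i(V′) = W_i(V)·T⁻¹` off the axis; `loopHol_update_b0_of_onAxis` — `W_i(V′) = T·W_i(V)·T⁻¹` on it;
* `loopHol_eq_of_eqOn_offForeign` ∕ `axialAvg_eq_of_eqOn_offForeign` — two configurations agreeing off the foreign distinguished bonds
  `b₀(c′)`, `c′ ≠ c`, have the same loop variables and the same coarse bond variable at `c`;
* `dist1_transportedFluct` — `|T − 1| = |V(b₀(c))⁻¹u − 1|`.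

HONEST FRAMING: kernel group algebra on the tree's torus walks; NOTHING of Bałaban's estimates asserted; no summit statement touched; one finite
four-torus programme downstream — not continuum ∕ ℝ⁴ ∕ OS ∕ mass gap ∕ Clay.
-/

namespace Literature.MathematicalPhysics.QuantumFieldTheory.Balaban1983to89

namespace B12B0LoopStructure267

open T4Continuum BlockAveraging AveragingRT B10Eq47AxialChi B12B0LoopGeometry267
open B12SmallFieldDomain259 (b0)

variable {P : Params} {j : ℕ} {G : Type*} [GaugeGroup G]

/-- The coarse bond variable as a straight product from the block centre. [cite: Balaban1987RG1, (0.4) p.253] -/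
theorem axialAvg_eq_rowProd (V : GaugeField P j G) (c : PBond P (j + 1)) :
    axialAvg V c = rowProd V (emb c.src) c.dir P.L := by
  rw [axialAvg_eq_holAt_walk, holAt_walk_replicate_true']

/-- The transport `g = V([emb c₋, b₀(c)₊])` along the axis is `V([emb c₋, b₀(c)₋])·V(b₀(c))`. [cite: Balaban1987RG1, p.267] -/
theorem rowProd_half_succ (V : GaugeField P j G) (c : PBond P (j + 1)) :
    rowProd V (emb c.src) c.dir ((P.L - 1) / 2 + 1) = rowProd V (emb c.src) c.dir ((P.L - 1) / 2) * V (b0 c) := by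
  rw [rowProd_succ, b0_eq_shiftN_emb]

/-- **THE COARSE BOND VARIABLE WITH `u` AT `b₀(c)`**: `V′(c) = T·V(c)`, `T = g·(V(b₀(c))⁻¹u)·g⁻¹`, `g = V([emb c₋, b₀(c)₊])`.
[cite: Balaban1987RG1, p.267] -/
theorem axialAvg_update_b0 [DecidableEq (PBond P j)] (hj : j + 1 ≤ P.m + P.K) (V : GaugeField P j G) (c : PBond P (j + 1)) (u : G) :
    axialAvg (Function.update V (b0 c) u) c =
      (rowProd V (emb c.src) c.dir ((P.L - 1) / 2 + 1) * ((V (b0 c))⁻¹ * u) * (rowProd V (emb c.src) c.dir ((P.L - 1) / 2 + 1))⁻¹) *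
        axialAvg V c := by
  obtain ⟨h0, h1⟩ := rowProd_axis_split hj V c u
  rw [axialAvg_eq_rowProd, axialAvg_eq_rowProd, h1, h0, rowProd_half_succ]
  group

/-- **OFF THE AXIS**: `W_i(V′) = W_i(V)·T⁻¹` (only the segment `(−c)` of the loop sees `b₀(c)`). [cite: Balaban1987RG1, (0.4) p.253 and p.267] -/
theorem loopHol_update_b0_of_offAxis [DecidableEq (PBond P j)] (hj : j + 1 ≤ P.m + P.K) (V : GaugeField P j G) (c : PBond P (j + 1))
    (u : G) (i : Idx P) (hoff : ¬ ∀ ν, ν ≠ c.dir → (i.1 ν : ℕ) = (P.L - 1) / 2) :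
    loopHol (Function.update V (b0 c) u) c i =
      loopHol V c i *
        (rowProd V (emb c.src) c.dir ((P.L - 1) / 2 + 1) * ((V (b0 c))⁻¹ * u) * (rowProd V (emb c.src) c.dir ((P.L - 1) / 2 + 1))⁻¹)⁻¹ := by
  rw [BlockAveragingEMLProp2.loopHol_eq, BlockAveragingEMLProp2.loopHol_eq, holAt_stair_update_b0 hj, holAt_stair_update_b0 hj,
    BlockAveragingEMLLinearised.walkEnd_emb_stairWord_eq_blockSite, holAt_walk_replicate_true', holAt_walk_replicate_true',
    rowProd_line_update_b0_of_offAxis hj V c i.1 hoff, axialAvg_update_b0 hj]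
  group

/-- **ON THE AXIS**: `W_i(V′) = T·W_i(V)·T⁻¹` (the loop sees `b₀(c)` forward in `[x,x′]` and backward in `(−c)`; the on-axis path identity
aligns the two transports). [cite: Balaban1987RG1, (0.4) p.253 and p.267] -/
theorem loopHol_update_b0_of_onAxis [DecidableEq (PBond P j)] (hj : j + 1 ≤ P.m + P.K) (V : GaugeField P j G) (c : PBond P (j + 1))
    (u : G) (i : Idx P) (hon : ∀ ν, ν ≠ c.dir → (i.1 ν : ℕ) = (P.L - 1) / 2) :
    loopHol (Function.update V (b0 c) u) c i =
      (rowProd V (emb c.src) c.dir ((P.L - 1) / 2 + 1) * ((V (b0 c))⁻¹ * u) * (rowProd V (emb c.src) c.dir ((P.L - 1) / 2 + 1))⁻¹) *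
        loopHol V c i *
        (rowProd V (emb c.src) c.dir ((P.L - 1) / 2 + 1) * ((V (b0 c))⁻¹ * u) * (rowProd V (emb c.src) c.dir ((P.L - 1) / 2 + 1))⁻¹)⁻¹ := by
  obtain ⟨hB0, hB1⟩ := rowProd_line_split_of_onAxis hj V c i.1 hon u
  have hpath := holAt_stair_mul_rowProd_of_onAxis hj V c i.2.1 i.1 hon
  rw [BlockAveragingEMLProp2.loopHol_eq, BlockAveragingEMLProp2.loopHol_eq, holAt_stair_update_b0 hj, holAt_stair_update_b0 hj,
    BlockAveragingEMLLinearised.walkEnd_emb_stairWord_eq_blockSite, holAt_walk_replicate_true', holAt_walk_replicate_true', hB1, hB0,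
    axialAvg_update_b0 hj, rowProd_half_succ]
  -- abbreviate
  set A := holAt V (walk (emb c.src) (stairWord i.2.1 (off i.1)))
  set q₁ := rowProd V (Site.blockSite c.src i.1) c.dir (P.L - 1 - i.1 c.dir)
  set p := rowProd V (emb c.src) c.dir ((P.L - 1) / 2)
  have hA : A = p * q₁⁻¹ := by rw [← hpath]; group
  rw [hA]
  group

/-- **THE LOOPS AT `c` ARE BLIND TO THE FOREIGN DISTINGUISHED BONDS**: two configurations that agree at every bond other than the `b₀(c′)`,
`c′ ≠ c`, have the same (0.4) loop variables at `c`. [cite: Balaban1987RG1, p.267] -/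
theorem loopHol_eq_of_eqOn_offForeign (hj : j + 1 ≤ P.m + P.K) (V V' : GaugeField P j G) (c : PBond P (j + 1))
    (hVV' : ∀ b : PBond P j, (∀ c' : PBond P (j + 1), c' ≠ c → b ≠ b0 c') → V' b = V b) (i : Idx P) :
    loopHol V' c i = loopHol V c i := by
  have hstair : ∀ (y : Site P (j + 1)) (σ : Equiv.Perm (Fin P.d)),
      holAt V' (walk (emb y) (stairWord σ (off i.1))) = holAt V (walk (emb y) (stairWord σ (off i.1))) := fun y σ =>
    T4ReflectionCone.holAt_congr fun s hs => hVV' s.bond fun c' _ => stair_bond_ne_b0 hj y σ i.1 c' s hs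
  have hline : ∀ r : Fin P.d → Fin P.L, rowProd V' (Site.blockSite c.src r) c.dir P.L = rowProd V (Site.blockSite c.src r) c.dir P.L :=
    fun r => rowProd_congr _ c.dir P.L fun t ht => hVV' _ fun c' hc' h => hc' (eq_of_line_bond_eq_b0 hj c r ht c' h)
  rw [BlockAveragingEMLProp2.loopHol_eq, BlockAveragingEMLProp2.loopHol_eq, hstair, hstair,
    BlockAveragingEMLLinearised.walkEnd_emb_stairWord_eq_blockSite, holAt_walk_replicate_true', holAt_walk_replicate_true', hline,
    axialAvg_eq_rowProd, axialAvg_eq_rowProd, emb_eq_blockSite, hline]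

/-- … and the same coarse bond variable at `c`. [cite: Balaban1987RG1, p.267] -/
theorem axialAvg_eq_of_eqOn_offForeign (hj : j + 1 ≤ P.m + P.K) (V V' : GaugeField P j G) (c : PBond P (j + 1))
    (hVV' : ∀ b : PBond P j, (∀ c' : PBond P (j + 1), c' ≠ c → b ≠ b0 c') → V' b = V b) :
    axialAvg V' c = axialAvg V c := by
  rw [axialAvg_eq_rowProd, axialAvg_eq_rowProd, emb_eq_blockSite]
  exact rowProd_congr _ c.dir P.L fun t ht => hVV' _ fun c' hc' h => hc' (eq_of_line_bond_eq_b0 hj c _ ht c' h)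

/-- `|T − 1| = |V(b₀(c))⁻¹u − 1|` (conjugation invariance of B7 (19)). [cite: Balaban1985Averaging, (19) p.21] -/
theorem dist1_transportedFluct (V : GaugeField P j G) (c : PBond P (j + 1)) (u : G) :
    dist1 (rowProd V (emb c.src) c.dir ((P.L - 1) / 2 + 1) * ((V (b0 c))⁻¹ * u) * (rowProd V (emb c.src) c.dir ((P.L - 1) / 2 + 1))⁻¹) =
      dist1 ((V (b0 c))⁻¹ * u) :=
  GaugeGroup.dist1_conj _ _

/-- There IS an on-axis index (`r ≡ (L−1)/2`) and, for `d ≥ 2`, an off-axis one (`r_ν = 0` at some `ν ≠ μ`; `(L−1)/2 ≥ 1`).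
[cite: Balaban1987RG1, (0.4) p.253 (bookkeeping)] -/
theorem exists_onAxis_and_offAxis (c : PBond P (j + 1)) (hd : 2 ≤ P.d) :
    (∃ i : Idx P, ∀ ν, ν ≠ c.dir → (i.1 ν : ℕ) = (P.L - 1) / 2) ∧ (∃ i : Idx P, ¬ ∀ ν, ν ≠ c.dir → (i.1 ν : ℕ) = (P.L - 1) / 2) := by
  refine ⟨⟨(fun _ => ⟨(P.L - 1) / 2, half_lt P⟩, 1, 1), fun _ _ => rfl⟩, ⟨(fun _ => ⟨0, P.L_pos⟩, 1, 1), fun h => ?_⟩⟩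
  have hL := P.hL.2
  obtain ⟨k, hk⟩ := P.hL.1
  obtain ⟨ν, hν⟩ : ∃ ν : Fin P.d, ν ≠ c.dir := by
    by_cases h0 : c.dir = ⟨0, by omega⟩
    · exact ⟨⟨1, by omega⟩, fun h => by rw [h0] at h; exact absurd (congrArg Fin.val h) (by simp)⟩
    · exact ⟨⟨0, by omega⟩, fun h => h0 h.symm⟩
  have := h ν hν
  dsimp only at this
  omega

end B12B0LoopStructure267

end Literature.MathematicalPhysics.QuantumFieldTheory.Balaban1983to89
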